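import Literature.RingTheory.PrincipalIdealRing.MonogenicLocalAlgebraTruncatedPolynomial
import HarnessLib

/-!
# Compatible coordinates on a tower of monogenic local Artin algebras: generators lift along surjections, and
# `A₀ ↞ A₁ ↞ ⋯` becomes the truncation tower `k[X]⧸(X^{N₀}) ↞ k[X]⧸(X^{N₁}) ↞ ⋯` of `k⟦X⟧`
# ([Tate 1967] §2.2, proof of Prop. 1 — the coordinate step; [Atiyah–Macdonald] Prop. 8.8)

Topic `Literature/RingTheory/PrincipalIdealRing`; namespace `Literature.RingTheory.PrincipalIdealRing`.  THEOREMS ONLY (no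
definition, no named fact, no instance, no notation, no `sorry`), sequel of ★ `MonogenicLocalAlgebraIdeals` (A–M 8.8: ideals of
an Artin local ring with principal `𝔪` are the `𝔪ʳ`) and ★ `MonogenicLocalAlgebraTruncatedPolynomial` (`A ≃ₐ[k] k[X]⧸(Xⁿ)`:
`aeval_surjective_of_maximalIdeal_eq_span`, `ker_aeval_eq_span_X_pow`).  Cell `hodgecm-mathlib`, P6 «MOD programme», sub-desk
F0P6d, sub-line 2 `Cruxes/HLiu418/Lines/F0_P6d_ConnectedBTDictionary.lean`, letter (HL-D) `ConnectedDimOneIsOModuleLaw`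
(«connected one-dimensional BT groups over a field are formal module laws»), strategy σ1 «coordinates on the monogenic tower»:
this file is its PURE-ALGEBRA half — the affine algebras `Γ(G_n) ≅ k[X]⧸(X^{p^{nH}})` of the layers, along the surjections
induced by the closed immersions `G_n ↪ G_{n+1}`, admit COMPATIBLE coordinates, so that the tower is the truncation tower of
`k⟦X⟧`.  (The scheme half — `Γ`, `incl`, the comultiplications and the passage to a Mathlib `FormalGroup` — is not here.)
HC_CM is proved only modulo the printed citations until rung 0 closes; nothing here is about HC.

THE PRINT.  [Tate1967] §2.2, proof of Prop. 1 («… `A_ν` … we can choose the isomorphisms … compatibly, so that `A = lim A_ν`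
is … a power series ring»): for a connected `p`-divisible group the affine algebras of the layers form a tower of local Artin
algebras with surjective transition maps, and coordinates can be chosen compatibly.  [AtiyahMacdonald1969] Ch. 8 Prop. 8.8
(and its proof: «hence `𝔪 = (x)` by Nakayama») supplies the one-ring facts: in an Artin local ring with principal `𝔪`, an
element of `𝔪 ∖ 𝔪²` generates `𝔪`.

MAIN STATEMENTS.  §1 `maximalIdeal_eq_span_of_not_mem_sq` (`x ∈ 𝔪 ∖ 𝔪²` generates), `map_maximalIdeal_sq_of_surjective`;
§2 **`exists_generator_lift`** — along a surjection `π : A′ ↠ A` of Artin local rings (`𝔪_{A′}` principal) every generator of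
`𝔪_A` is the image of a generator of `𝔪_{A′}`; §3 **`exists_compatible_generators`** (a tower `π_n : A_{n+1} ↠ A_n` has generators
`x_n` with `π_n x_{n+1} = x_n`), `nilpotencyClass_le_of_map_eq`; §4 **`exists_algEquiv_quotient_X_pow_apply_mk`** (over a field `k`,
residue field `k`: a coordinate `k[X]⧸(X^N) ≃ₐ[k] A` SENDING `X̄` to a chosen generator, `N` its nilpotency index),
`span_X_pow_le_span_X_pow`, **`comp_algEquiv_eq_of_apply_mk`** ∕ `apply_algEquiv_eq_of_apply_mk` (coordinates at compatible
generators intertwine `π` with the truncation `k[X]⧸(X^{N′}) → k[X]⧸(X^N)`); §5 **`exists_compatible_coordinates`** — THE TOWER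
THEOREM: generators `x_n`, coordinates `φ_n : k[X]⧸(X^{N_n}) ≃ₐ[k] A_n` with `φ_n X̄ = x_n`, `N_n` non-decreasing, and
`π_n (φ_{n+1} f̄) = φ_n f̄` for all `f ∈ k[X]`.

## References
* [Tate1967] J. T. Tate, *p-divisible groups*, Proc. Conf. Local Fields (Driebergen, 1966), Springer (1967) — §2.2, proof of
  Prop. 1.
* [AtiyahMacdonald1969] M. F. Atiyah, I. G. Macdonald, *Introduction to Commutative Algebra* (1969) — Ch. 8, Prop. 8.8 and the
  Example following it.
-/

namespace Literature.RingTheory.PrincipalIdealRing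

open IsLocalRing Polynomial

universe u v w

/-! ## §1 One local Artin ring with principal maximal ideal: elements of `𝔪 ∖ 𝔪²` generate `𝔪` -/

section One

variable {A : Type v} [CommRing A] [IsLocalRing A] [IsArtinianRing A]

/-- In an Artin local ring with `𝔪 = (p)`, an element of `𝔪` not in `𝔪²` generates `𝔪` (it is `e·p` with `e` a unit).
[cite: AtiyahMacdonald1969, Ch. 8, Prop. 8.8 (proof)] -/
theorem maximalIdeal_eq_span_of_not_mem_sq {p x : A} (hp : maximalIdeal A = Ideal.span {p})
    (hx : x ∈ maximalIdeal A) (hx2 : x ∉ maximalIdeal A ^ 2) : maximalIdeal A = Ideal.span {x} := by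
  have hx0 : x ≠ 0 := by rintro rfl; exact hx2 (Ideal.zero_mem _)
  obtain ⟨j, e, he, rfl⟩ := exists_isUnit_mul_pow hp (isNilpotent_of_maximalIdeal_eq_span hp) x hx0
  have hpm : p ∈ maximalIdeal A := hp ▸ Ideal.mem_span_singleton_self p
  -- `j ≠ 0` since `e·p⁰ = e` is a unit, not in `𝔪`
  have hj0 : j ≠ 0 := by
    rintro rfl
    rw [pow_zero, mul_one] at hx
    exact (IsLocalRing.mem_maximalIdeal _).mp hx he
  -- `j < 2` since `e·p^j ∈ 𝔪² = (p²)` for `j ≥ 2`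
  have hj2 : j < 2 := by
    by_contra hj
    apply hx2
    rw [hp]
    exact Ideal.mul_mem_left _ e (Ideal.pow_le_pow_right (not_lt.mp hj)
      (Ideal.pow_mem_pow (Ideal.mem_span_singleton_self p) j))
  obtain rfl : j = 1 := by omega
  rw [pow_one, hp, Ideal.span_singleton_mul_left_unit he]

omit [IsArtinianRing A] in
/-- A surjection of local rings maps `𝔪²` onto `𝔪²`. [cite: AtiyahMacdonald1969, Ch. 8, Prop. 8.8 (proof)] -/
theorem map_maximalIdeal_sq_of_surjective {A' : Type w} [CommRing A'] [IsLocalRing A'] (π : A' →+* A)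
    (hπ : Function.Surjective π) : (maximalIdeal A' ^ 2).map π = maximalIdeal A ^ 2 := by
  rw [Ideal.map_pow, IsLocalRing.map_maximalIdeal_of_surjective π hπ]

end One

/-! ## §2 Generators lift along surjections -/

section Lift

variable {A' : Type w} [CommRing A'] [IsLocalRing A'] [IsArtinianRing A']
  {A : Type v} [CommRing A] [IsLocalRing A] [IsArtinianRing A]

/-- **Generators of the maximal ideal lift along surjections.**  Let `π : A′ ↠ A` be a surjection of Artin local rings,
`𝔪_{A′}` principal.  Then every generator `x` of `𝔪_A` is the image of a generator `x′` of `𝔪_{A′}`.  (A lift `x′ ∈ 𝔪′` of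
`x` avoids `𝔪′²` unless `𝔪_A ⊆ 𝔪_A²`, i.e. `𝔪_A = 0` by Nakayama — in which case any generator of `𝔪′` will do; and an element
of `𝔪′ ∖ 𝔪′²` generates.) [cite: AtiyahMacdonald1969, Ch. 8, Prop. 8.8 (proof)] [cite: Tate1967, §2.2 (proof of Prop. 1)] -/
theorem exists_generator_lift (π : A' →+* A) (hπ : Function.Surjective π) (h' : (maximalIdeal A').IsPrincipal) {x : A}
    (hx : maximalIdeal A = Ideal.span {x}) : ∃ x' : A', maximalIdeal A' = Ideal.span {x'} ∧ π x' = x := by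
  obtain ⟨p', hp'⟩ := h'.principal
  have hp'' : maximalIdeal A' = Ideal.span {p'} := hp'
  have hmap : (maximalIdeal A').map π = maximalIdeal A := IsLocalRing.map_maximalIdeal_of_surjective π hπ
  have hxm : x ∈ maximalIdeal A := hx ▸ Ideal.mem_span_singleton_self x
  -- a lift of `x`; it lies in `𝔪′` because `π` detects units
  haveI := IsLocalHom.of_surjective π hπ
  obtain ⟨x', hx'⟩ := hπ x
  have hx'm : x' ∈ maximalIdeal A' := by
    by_contra h
    exact (IsLocalRing.mem_maximalIdeal _).mp hxm (hx' ▸ (IsLocalRing.notMem_maximalIdeal.mp h).map π)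
  by_cases hx'2 : x' ∈ maximalIdeal A' ^ 2
  · -- then `x ∈ 𝔪²`, so `𝔪 = (x) ⊆ 𝔪²`, `𝔪 = 0` by Nakayama, `x = 0`, and the generator `p′` maps into `𝔪 = 0`
    have hx2 : x ∈ maximalIdeal A ^ 2 := by
      rw [← map_maximalIdeal_sq_of_surjective π hπ, ← hx']; exact Ideal.mem_map_of_mem π hx'2
    have hmm : maximalIdeal A = ⊥ := by
      have hle : maximalIdeal A ≤ maximalIdeal A ^ 2 := by
        rw [hx, Ideal.span_singleton_le_iff_mem]; exact hx ▸ hx2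
      have hfg : (maximalIdeal A).FG := IsNoetherian.noetherian _
      exact Submodule.eq_bot_of_le_smul_of_le_jacobson_bot (maximalIdeal A) (maximalIdeal A) hfg
        (by rw [smul_eq_mul, ← pow_two]; exact hle) (le_of_eq (IsLocalRing.jacobson_eq_maximalIdeal ⊥ bot_ne_top).symm)
    refine ⟨p', hp'', ?_⟩
    have h0 : x = 0 := by
      have : x ∈ (⊥ : Ideal A) := hmm ▸ hxm
      simpa using this
    have : π p' ∈ maximalIdeal A := hmap ▸ Ideal.mem_map_of_mem π (hp'' ▸ Ideal.mem_span_singleton_self p')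
    rw [hmm] at this
    simpa [h0] using this
  · exact ⟨x', maximalIdeal_eq_span_of_not_mem_sq hp'' hx'm hx'2, hx'⟩

end Lift


/-! ## §3 Towers: compatible generators -/

section Tower

variable (A : ℕ → Type v) [∀ n, CommRing (A n)] [∀ n, IsLocalRing (A n)] [∀ n, IsArtinianRing (A n)]
  (π : ∀ n, A (n + 1) →+* A n)

/-- **Compatible generators on a tower**: along surjections `π_n : A_{n+1} ↠ A_n` of Artin local rings with principal maximal
ideals there are generators `x_n` of `𝔪_{A_n}` with `π_n x_{n+1} = x_n` (recursion on `n` with `exists_generator_lift`).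
[cite: Tate1967, §2.2 (proof of Prop. 1)] [cite: AtiyahMacdonald1969, Ch. 8, Prop. 8.8] -/
theorem exists_compatible_generators (hπ : ∀ n, Function.Surjective (π n))
    (h : ∀ n, (maximalIdeal (A n)).IsPrincipal) :
    ∃ x : ∀ n, A n, (∀ n, maximalIdeal (A n) = Ideal.span {x n}) ∧ ∀ n, π n (x (n + 1)) = x n := by
  classical
  obtain ⟨x0, hx0⟩ := (h 0).principal
  have hx0' : maximalIdeal (A 0) = Ideal.span {x0} := hx0
  let seq : ∀ n, {y : A n // maximalIdeal (A n) = Ideal.span {y}} := fun n =>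
    Nat.rec (motive := fun n => {y : A n // maximalIdeal (A n) = Ideal.span {y}}) ⟨x0, hx0'⟩
      (fun n ih => ⟨Classical.choose (exists_generator_lift (π n) (hπ n) (h (n + 1)) ih.2),
        (Classical.choose_spec (exists_generator_lift (π n) (hπ n) (h (n + 1)) ih.2)).1⟩) n
  refine ⟨fun n => (seq n).1, fun n => (seq n).2, fun n => ?_⟩
  exact (Classical.choose_spec (exists_generator_lift (π n) (hπ n) (h (n + 1)) (seq n).2)).2

omit [∀ n, IsLocalRing (A n)] [∀ n, IsArtinianRing (A n)] in
/-- Along the tower the nilpotency indices of compatible generators do not decrease. [cite: Tate1967, §2.2 (proof of Prop. 1)] -/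
theorem nilpotencyClass_le_of_map_eq {n : ℕ} {x' : A (n + 1)} {x : A n} (hx' : IsNilpotent x') (hxx : π n x' = x) :
    nilpotencyClass x ≤ nilpotencyClass x' := by
  refine Nat.sInf_le ?_
  show x ^ nilpotencyClass x' = 0
  rw [← hxx, ← map_pow, pow_nilpotencyClass hx', map_zero]

end Tower

/-! ## §4 Coordinates: `k[X]⧸(X^N) ≃ A` sending `X̄` to a chosen generator, and their compatibility -/

section Coordinates

variable {k : Type u} [Field k]

/-- **Coordinate at a chosen generator.**  For an Artin local `k`-algebra `A` with residue field `k` (elementwise `hres`) and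
`𝔪 = (p)`, there is a `k`-algebra isomorphism `k[X]⧸(X^N) ≃ A`, `N` the nilpotency index of `p`, SENDING `X̄` TO `p` (the
evaluation `X ↦ p` is onto with kernel `(X^N)`, ★ `aeval_surjective_of_maximalIdeal_eq_span` ∕ ★ `ker_aeval_eq_span_X_pow`).
[cite: AtiyahMacdonald1969, Ch. 8, Prop. 8.8 and Example] -/
theorem exists_algEquiv_quotient_X_pow_apply_mk {A : Type v} [CommRing A] [Algebra k A] [IsLocalRing A] [IsArtinianRing A]
    {p : A} (hp : maximalIdeal A = Ideal.span {p}) (hres : ∀ a : A, ∃ c : k, a - algebraMap k A c ∈ maximalIdeal A) :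
    ∃ φ : (k[X] ⧸ Ideal.span {(X : k[X]) ^ nilpotencyClass p}) ≃ₐ[k] A,
      φ (Ideal.Quotient.mk _ X) = p := by
  refine ⟨(Ideal.quotientEquivAlgOfEq k (ker_aeval_eq_span_X_pow (k := k) hp).symm).trans
    (Ideal.quotientKerAlgEquivOfSurjective (aeval_surjective_of_maximalIdeal_eq_span hp hres)), ?_⟩
  rw [AlgEquiv.trans_apply, Ideal.quotientEquivAlgOfEq_mk, Ideal.quotientKerAlgEquivOfSurjective_mk, aeval_X]

/-- `(X^{N′}) ≤ (X^N)` for `N ≤ N′` (the truncation map `k[X]⧸(X^{N′}) → k[X]⧸(X^N)` exists).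
[cite: AtiyahMacdonald1969, Ch. 8, Prop. 8.8 and Example] -/
theorem span_X_pow_le_span_X_pow {N N' : ℕ} (h : N ≤ N') :
    Ideal.span {(X : k[X]) ^ N'} ≤ Ideal.span {(X : k[X]) ^ N} :=
  Ideal.span_singleton_le_span_singleton.mpr (pow_dvd_pow X h)

/-- **Compatibility of coordinates**: if `π : A′ → A` is a `k`-algebra map with `π x′ = x`, and `φ′ : k[X]⧸(X^{N′}) ≃ A′`, `φ :
k[X]⧸(X^N) ≃ A` send `X̄` to `x′`, `x` (`N ≤ N′`), then `π ∘ φ′ = φ ∘ (truncation)` — coordinates chosen at compatible generators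
INTERTWINE the surjections of the tower with the truncations `k[X]⧸(X^{N′}) → k[X]⧸(X^N)`.
[cite: Tate1967, §2.2 (proof of Prop. 1)] -/
theorem comp_algEquiv_eq_of_apply_mk {A' : Type w} [CommRing A'] [Algebra k A'] {A : Type v} [CommRing A] [Algebra k A]
    (π : A' →ₐ[k] A) {N N' : ℕ} (hN : N ≤ N') {x' : A'} {x : A} (hxx : π x' = x)
    (φ' : (k[X] ⧸ Ideal.span {(X : k[X]) ^ N'}) ≃ₐ[k] A') (hφ' : φ' (Ideal.Quotient.mk _ X) = x')
    (φ : (k[X] ⧸ Ideal.span {(X : k[X]) ^ N}) ≃ₐ[k] A) (hφ : φ (Ideal.Quotient.mk _ X) = x) :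
    π.comp (φ' : (k[X] ⧸ Ideal.span {(X : k[X]) ^ N'}) →ₐ[k] A') =
      (φ : (k[X] ⧸ Ideal.span {(X : k[X]) ^ N}) →ₐ[k] A).comp
        (Ideal.Quotient.factorₐ k (span_X_pow_le_span_X_pow hN)) := by
  refine Ideal.Quotient.algHom_ext _ (Polynomial.algHom_ext ?_)
  simp only [AlgHom.comp_apply, Ideal.Quotient.mkₐ_eq_mk, AlgEquiv.coe_toAlgHom, Ideal.Quotient.factorₐ_apply_mk, hφ', hφ, hxx]

/-- Elementwise form of the compatibility: `π (φ′ f̄) = φ (f̄ truncated)`. [cite: Tate1967, §2.2 (proof of Prop. 1)] -/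
theorem apply_algEquiv_eq_of_apply_mk {A' : Type w} [CommRing A'] [Algebra k A'] {A : Type v} [CommRing A] [Algebra k A]
    (π : A' →ₐ[k] A) {N N' : ℕ} (hN : N ≤ N') {x' : A'} {x : A} (hxx : π x' = x)
    (φ' : (k[X] ⧸ Ideal.span {(X : k[X]) ^ N'}) ≃ₐ[k] A') (hφ' : φ' (Ideal.Quotient.mk _ X) = x')
    (φ : (k[X] ⧸ Ideal.span {(X : k[X]) ^ N}) ≃ₐ[k] A) (hφ : φ (Ideal.Quotient.mk _ X) = x) (f : k[X]) :
    π (φ' (Ideal.Quotient.mk _ f)) = φ (Ideal.Quotient.mk _ f) := by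
  have h := congrArg (fun ψ => ψ (Ideal.Quotient.mk _ f)) (comp_algEquiv_eq_of_apply_mk π hN hxx φ' hφ' φ hφ)
  simpa only [AlgHom.comp_apply, AlgEquiv.coe_toAlgHom, Ideal.Quotient.factorₐ_apply_mk] using h

end Coordinates

/-! ## §5 The tower theorem -/

/-- **COMPATIBLE COORDINATES ON A MONOGENIC TOWER.**  Let `k` be a field and `A₀ ↞ A₁ ↞ A₂ ↞ ⋯` a tower of SURJECTIVE `k`-algebra
maps between Artin local `k`-algebras with residue field `k` (elementwise) and principal maximal ideals (each `A_n ≅ k[X]⧸(X^{N})`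
abstractly, ★ `nonempty_algEquiv_polynomial_quotient_X_pow`).  Then there are generators `x_n` of `𝔪_{A_n}` with
`π_n x_{n+1} = x_n` and coordinates `φ_n : k[X]⧸(X^{N_n}) ≃ₐ[k] A_n`, `N_n = nilpotencyClass x_n` non-decreasing, `φ_n X̄ = x_n`,
such that `π_n (φ_{n+1} f̄) = φ_n f̄` for every `f ∈ k[X]`: in these coordinates the tower IS the truncation tower of `k⟦X⟧`.
(The coordinate step in [Tate1967] §2.2, proof of Prop. 1, for a connected `p`-divisible group of dimension one: the affine
algebras of `G_ν` form such a tower along the closed immersions `i_ν`.) [cite: Tate1967, §2.2 (proof of Prop. 1)]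
[cite: AtiyahMacdonald1969, Ch. 8, Prop. 8.8 and Example] -/
theorem exists_compatible_coordinates {k : Type u} [Field k] (A : ℕ → Type v) [∀ n, CommRing (A n)] [∀ n, Algebra k (A n)]
    [∀ n, IsLocalRing (A n)] [∀ n, IsArtinianRing (A n)] (π : ∀ n, A (n + 1) →ₐ[k] A n)
    (hπ : ∀ n, Function.Surjective (π n)) (h : ∀ n, (maximalIdeal (A n)).IsPrincipal)
    (hres : ∀ n (a : A n), ∃ c : k, a - algebraMap k (A n) c ∈ maximalIdeal (A n)) :
    ∃ (x : ∀ n, A n) (φ : ∀ n, (k[X] ⧸ Ideal.span {(X : k[X]) ^ nilpotencyClass (x n)}) ≃ₐ[k] A n),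
      (∀ n, maximalIdeal (A n) = Ideal.span {x n}) ∧ (∀ n, π n (x (n + 1)) = x n) ∧
      (∀ n, nilpotencyClass (x n) ≤ nilpotencyClass (x (n + 1))) ∧
      (∀ n, φ n (Ideal.Quotient.mk _ X) = x n) ∧
      ∀ n (f : k[X]), π n (φ (n + 1) (Ideal.Quotient.mk _ f)) = φ n (Ideal.Quotient.mk _ f) := by
  obtain ⟨x, hx, hπx⟩ := exists_compatible_generators A (fun n => (π n).toRingHom) hπ h
  have hφ := fun n => exists_algEquiv_quotient_X_pow_apply_mk (hx n) (hres n)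
  choose φ hφ using hφ
  have hN : ∀ n, nilpotencyClass (x n) ≤ nilpotencyClass (x (n + 1)) := fun n =>
    nilpotencyClass_le_of_map_eq A (fun n => (π n).toRingHom)
      (isNilpotent_of_maximalIdeal_eq_span (hx (n + 1))) (hπx n)
  exact ⟨x, φ, hx, hπx, hN, hφ, fun n f =>
    apply_algEquiv_eq_of_apply_mk (π n) (hN n) (hπx n) (φ (n + 1)) (hφ (n + 1)) (φ n) (hφ n) f⟩

end Literature.RingTheory.PrincipalIdealRing
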